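import Literature.Topology.FourManifolds.KirbyMovesReverseProofs
import Literature.Topology.FourManifolds.KirbyMovesIsotopyProofs
import Literature.Topology.FourManifolds.LinkingNumber
import HarnessLib

/-!
# Surgery on the mirror image of a framed link: discharge of `FramedLink.isSurgery_mirror_iff`

Sibling proof file of `KirbyMoves.lean` (D-0014: named facts `def X : Prop` are discharged as
`theorem X_holds : X`). It discharges

* `Literature.FramedLink.isSurgery_mirror_iff_holds : FramedLink.isSurgery_mirror_iff` — **a smooth
  3-manifold `Y` is surgery on the mirrored framed link `L̄` (all components reflected by
  `reflectLast 3`, all framings negated) iff it is surgery on `L`** (as unoriented manifolds; the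
  orientation inherited from `S³` is reversed);

and, with the same mirrored tubular neighbourhood, the named fact of `LinkingNumber.lean`

* `Literature.Knot.HasLinkingNumber.mirror_holds : HasLinkingNumber.mirror` — **`lk(K̄, J̄) = -lk(K, J)`**
  (Rolfsen (1976), §5.D, remark after Thm 5.D.1): the reflected loop of `J` has class
  `l • [μ̄]⁻¹ = (-l) • [μ̄]` with respect to the meridian `μ̄` of `ν.mirrorKnot`.

Both directions are `Literature.Topology.FourManifolds.FramedLink.IsSurgery.mirror` (`L̄̄ = L`), the transport of a surgery
presentation `(ν, jA, jB)` of `Y` on `L` (`Literature.Topology.FourManifolds.IsIntegralSurgeryLink`, `DehnSurgery.lean`) to one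
on `L̄`, in the style of the reversal (`KirbyMovesReverseProofs.lean`) and isotopy
(`KirbyMovesIsotopyProofs.lean`) transports:

* `Literature.Topology.FourManifolds.Knot.TubularNbhd.mirror`: `R ∘ ν ∘ (id × planeFlip)` (`R = reflectLast 3`,
  `planeFlip (w₀, w₁) = (w₀, -w₁)`) is an oriented tubular neighbourhood of the mirrored knot
  `R ∘ K`: the ambient reflection reverses the sign of the frame determinant of `det_pos` and so
  does the fibre reflection, so the two cancel (`det_of_reflect_neg`; the rows are computed with
  `deriv (R ∘ f) = R (deriv f)`, `deriv_clm_comp_apply`, the rows being differentiable by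
  `contDiff_paramCoe`);
* `Literature.Topology.FourManifolds.Knot.TubularNbhd.HasFraming.mirrorKnot`: its framing is `-m` — under the reflection of
  complements (`toMirrorCompl`) the longitude goes to the longitude but the meridian to the
  reversed meridian (`longitude_mirrorKnot`, `meridian_mirrorKnot`), so `[λ] = m • [μ]` becomes
  `[λ'] = (-m) • [μ']` in the abelianised fundamental group (`FundamentalGroup.mapOfEq`,
  `Abelianization.map`);
* `Literature.Topology.FourManifolds.Knot.TubularNbhd.glueRel_mirror_iff`: the surgery relation of the mirrored neighbourhood at
  `(a, (p, v))` is that of `ν` at `(R a, (p, v̄))`; accordingly the new presentation is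
  `jA ∘ R` on the complement of `L̄` (`Link.mirrorComplDiffeo`, `R` being an involution of `S³`
  exchanging the two complements) and `jBᵢ ∘ solidTorusCircleFlip` on the solid tori
  (`(p, v) ↦ (p, v̄)`).

## References

* R. E. Gompf, A. I. Stipsicz, *4-Manifolds and Kirby Calculus*, AMS GSM 20 (1999), §5.1
  (reversing the orientation of `∂M_L`: mirror the diagram and negate all framings).
  [cite: GompfStipsicz1999, §5.1]
* D. Rolfsen, *Knots and Links* (1976), §9.H. [cite: Rolfsen1976, §9.H]
-/

open scoped Manifold ContDiff Topology
open Function Set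

noncomputable section

universe u v w u'

namespace Literature.Topology.FourManifolds

/-- Local notation: `𝔼 n` is the model Euclidean space `EuclideanSpace ℝ (Fin n)`. -/
local notation "𝔼 " n:arg => EuclideanSpace ℝ (Fin n)

/-- Local notation: `𝕊 n` is the unit sphere in `EuclideanSpace ℝ (Fin (n + 1))`. -/
local notation "𝕊 " n:arg => (Metric.sphere (0 : EuclideanSpace ℝ (Fin (n + 1))) 1)

attribute [local instance] fact_finrank_euclideanSpace_two fact_finrank_euclideanSpace_four

/-! ## Mirror image: surgery on the mirrored framed link -/

section MirrorHelpers

variable {X Y : Type*} [TopologicalSpace X] [TopologicalSpace Y]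

/-- In a fundamental group, the class of a transported loop (cast to a new base point) is the image
of its class under the induced homomorphism. [folklore] -/
theorem fromPath_mk_cast_map_eq (g : C(X, Y)) {x : X} {y : Y} (hb : g x = y) (γ : Path x x) :
    FundamentalGroup.fromPath (Path.Homotopic.Quotient.mk ((γ.map g.continuous).cast hb.symm hb.symm)) =
      FundamentalGroup.mapOfEq g hb (FundamentalGroup.fromPath (Path.Homotopic.Quotient.mk γ)) := by
  rw [FundamentalGroup.mapOfEq_apply, Path.Homotopic.Quotient.mk_cast, Path.Homotopic.Quotient.mk_map]

/-- In a fundamental group, the class of a reversed transported loop is the inverse of the image of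
its class under the induced homomorphism. [folklore] -/
theorem fromPath_mk_symm_cast_map_eq (g : C(X, Y)) {x : X} {y : Y} (hb : g x = y) (γ : Path x x) :
    FundamentalGroup.fromPath (Path.Homotopic.Quotient.mk
      ((γ.map g.continuous).cast hb.symm hb.symm).symm) =
      (FundamentalGroup.mapOfEq g hb (FundamentalGroup.fromPath (Path.Homotopic.Quotient.mk γ)))⁻¹ := by
  rw [FundamentalGroup.mapOfEq_apply, FundamentalGroup.inv_def, Path.Homotopic.Quotient.mk_symm,
    Path.Homotopic.Quotient.mk_cast, Path.Homotopic.Quotient.mk_map]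

end MirrorHelpers

/-- The flip `(p, v) ↦ (p, v̄)` of `ℝ² × 𝕊 1` (reflection of the circle factor only), as a
diffeomorphism. [folklore] -/
def circleFactorFlip :
    ((𝔼 2) × (𝕊 1)) ≃ₘ⟮𝓘(ℝ, 𝔼 2).prod (𝓡 1), 𝓘(ℝ, 𝔼 2).prod (𝓡 1)⟯ ((𝔼 2) × (𝕊 1)) :=
  (Diffeomorph.refl 𝓘(ℝ, 𝔼 2) (𝔼 2) ∞).prodCongr (reflectLastDiffeo 1)

/-- The circle-factor flip on points. [folklore] -/
@[simp] theorem circleFactorFlip_apply (b : (𝔼 2) × (𝕊 1)) :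
    circleFactorFlip b = (b.1, reflectLast 1 b.2) := rfl

/-- The circle-factor flip is an involution. [folklore] -/
theorem circleFactorFlip_circleFactorFlip (b : (𝔼 2) × (𝕊 1)) :
    circleFactorFlip (circleFactorFlip b) = b := by
  simp

/-- The circle-factor flip preserves the open solid torus. [folklore] -/
theorem circleFactorFlip_mem_solidTorus {b : (𝔼 2) × (𝕊 1)} (hb : b ∈ solidTorus) :
    circleFactorFlip b ∈ solidTorus := by
  rw [mem_solidTorus_iff] at hb ⊢
  simpa using hb

/-- **The circle-factor flip of the open solid torus** `(p, v) ↦ (p, v̄)`, a self-diffeomorphism of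
the open submanifold `solidTorus ⊆ ℝ² × 𝕊 1`. [folklore] -/
def solidTorusCircleFlip :
    solidTorus ≃ₘ⟮𝓘(ℝ, 𝔼 2).prod (𝓡 1), 𝓘(ℝ, 𝔼 2).prod (𝓡 1)⟯ solidTorus where
  toFun b := ⟨circleFactorFlip b, circleFactorFlip_mem_solidTorus b.2⟩
  invFun b := ⟨circleFactorFlip b, circleFactorFlip_mem_solidTorus b.2⟩
  left_inv _ := Subtype.ext (circleFactorFlip_circleFactorFlip _)
  right_inv _ := Subtype.ext (circleFactorFlip_circleFactorFlip _)
  contMDiff_toFun := (ContMDiff.subtypeVal_comp_iff solidTorus _).1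
    (circleFactorFlip.contMDiff.comp contMDiff_subtype_val)
  contMDiff_invFun := (ContMDiff.subtypeVal_comp_iff solidTorus _).1
    (circleFactorFlip.contMDiff.comp contMDiff_subtype_val)

/-- The circle-factor flip of the solid torus on points. [folklore] -/
@[simp] theorem coe_solidTorusCircleFlip (b : solidTorus) :
    (solidTorusCircleFlip b : (𝔼 2) × (𝕊 1)) = circleFactorFlip b := rfl

/-- Precomposing with the circle-factor flip does not change the image. [folklore] -/
theorem range_comp_solidTorusCircleFlip {Y : Type*} (f : solidTorus → Y) :
    range (f ∘ solidTorusCircleFlip) = range f :=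
  (EquivLike.surjective solidTorusCircleFlip).range_comp f

/-- The ambient reflection `reflectLast 3` on `ℝ⁴` negates the last coordinate. [folklore] -/
theorem reflectLastCLM_three_apply (v : 𝔼 4) (j : Fin 4) :
    reflectLastCLM 3 v j = if j = 3 then -v j else v j := by
  simp [reflectLastCLM]

namespace Knot.TubularNbhd

variable {K : 𝕊 1 → 𝕊 3} (ν : Knot.TubularNbhd K)

/-- Applying the reflection `reflectLast 3` of `ℝ⁴` to all four rows of a frame and negating the
last row does not change the determinant (`det R = -1` twice). [folklore] -/
theorem det_of_reflect_neg (a b c d : 𝔼 4) :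
    Matrix.det (Matrix.of ![⇑(reflectLastCLM 3 a), ⇑(reflectLastCLM 3 b), ⇑(reflectLastCLM 3 c),
      ⇑(reflectLastCLM 3 (-d))]) = Matrix.det (Matrix.of ![⇑a, ⇑b, ⇑c, ⇑d]) := by
  have h : Matrix.of ![⇑(reflectLastCLM 3 a), ⇑(reflectLastCLM 3 b), ⇑(reflectLastCLM 3 c),
      ⇑(reflectLastCLM 3 (-d))] =
      Matrix.diagonal ![1, 1, 1, -1] * Matrix.of ![⇑a, ⇑b, ⇑c, ⇑d] * Matrix.diagonal ![1, 1, 1, -1] := by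
    ext i j
    rw [Matrix.mul_diagonal, Matrix.diagonal_mul]
    fin_cases i <;> fin_cases j <;> simp [reflectLastCLM_three_apply]
  rw [h, Matrix.det_mul, Matrix.det_mul, Matrix.det_diagonal]
  simp [Fin.prod_univ_four]

/-- The rows of the frame of `ν` are differentiable functions: the angle direction. [folklore] -/
theorem differentiableAt_row_fst (w : 𝔼 2) (θ : ℝ) :
    DifferentiableAt ℝ (fun t : ℝ ↦ ((ν (circlePoint t, w) : 𝕊 3) : 𝔼 4)) θ := by
  have hd := ν.contDiff_paramCoe.differentiable (by simp)
  have : (fun t : ℝ ↦ ((ν (circlePoint t, w) : 𝕊 3) : 𝔼 4)) = ν.paramCoe ∘ fun t ↦ (t, w) := rfl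
  rw [this]
  exact (hd (θ, w)).comp θ ((differentiableAt_id).prodMk (differentiableAt_const w))

/-- The rows of the frame of `ν` are differentiable functions: the fibre directions. [folklore] -/
theorem differentiableAt_row_snd (w : 𝔼 2) (θ : ℝ) (i : Fin 2) (s : ℝ) :
    DifferentiableAt ℝ (fun s : ℝ ↦ ((ν (circlePoint θ, w + EuclideanSpace.single i s) : 𝕊 3) :
      𝔼 4)) s := by
  have hd := ν.contDiff_paramCoe.differentiable (by simp)
  have h1 : DifferentiableAt ℝ (fun s : ℝ ↦ w + EuclideanSpace.single i s) s := by
    have : (fun s : ℝ ↦ w + EuclideanSpace.single i s) =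
        fun s : ℝ ↦ w + s • EuclideanSpace.single i (1 : ℝ) := by
      funext s; rw [← euclideanSpace_single_eq_smul]
    rw [this]
    exact (differentiableAt_id.smul_const _).const_add w
  have : (fun s : ℝ ↦ ((ν (circlePoint θ, w + EuclideanSpace.single i s) : 𝕊 3) : 𝔼 4)) =
      ν.paramCoe ∘ fun s ↦ (θ, w + EuclideanSpace.single i s) := rfl
  rw [this]
  exact (hd (θ, _)).comp s ((differentiableAt_const θ).prodMk h1)

/-- A continuous linear map commutes with `deriv` at points of differentiability. [folklore] -/
theorem deriv_clm_comp_apply {F G : Type*} [NormedAddCommGroup F] [NormedSpace ℝ F]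
    [NormedAddCommGroup G] [NormedSpace ℝ G] (A : F →L[ℝ] G) {f : ℝ → F} {x : ℝ}
    (hf : DifferentiableAt ℝ f x) : deriv (fun t ↦ A (f t)) x = A (deriv f x) :=
  (A.hasFDerivAt.comp_hasDerivAt x hf.hasDerivAt).deriv

/-- **The mirrored tubular neighbourhood.** Composing an oriented tubular neighbourhood `ν` of `K`
with the reflection `reflectLast 3` of the ambient sphere (orientation reversing) and with the
reflection `(w₀, w₁) ↦ (w₀, -w₁)` of the fibre gives an oriented tubular neighbourhood of the
mirrored knot `reflectLast 3 ∘ K`: the two orientation reversals cancel in `det_pos`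
(`det_of_reflect_neg`). Its meridian is the reflected *reversed* meridian and its longitude the
reflected longitude, whence the framing is negated (`HasFraming.mirrorKnot`). Gompf–Stipsicz
(1999), §5.1 (mirror the diagram and negate the framings); Rolfsen (1976), §9.H.
[cite: GompfStipsicz1999, §5.1] -/
def mirror : Knot.TubularNbhd (reflectLast 3 ∘ K) where
  toFun p := reflectLast 3 (ν (p.1, planeFlip p.2))
  isSmoothEmbedding := by
    have : (fun p : (𝕊 1) × (𝔼 2) ↦ reflectLast 3 (ν (p.1, planeFlip p.2))) =
        ⇑(reflectLastDiffeo 3) ∘ (⇑ν ∘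
          ⇑((Diffeomorph.refl (𝓡 1) (𝕊 1) ∞).prodCongr planeFlip.toDiffeomorph)) := by
      funext p; rfl
    rw [this]
    exact (ν.isSmoothEmbedding_coe.comp_diffeomorph _).diffeomorph_comp (reflectLastDiffeo 3)
  apply_zero x := by
    change reflectLast 3 (ν (x, planeFlip 0)) = reflectLast 3 (K x)
    rw [map_zero, ν.coe_apply_zero]
  det_pos θ w := by
    set F₁ : ℝ → 𝔼 4 := fun t ↦ ((ν (circlePoint t, planeFlip w) : 𝕊 3) : 𝔼 4) with hF₁
    set F₂ : ℝ → 𝔼 4 := fun s ↦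
      ((ν (circlePoint θ, planeFlip w + EuclideanSpace.single 0 s) : 𝕊 3) : 𝔼 4) with hF₂
    set F₃ : ℝ → 𝔼 4 := fun s ↦
      ((ν (circlePoint θ, planeFlip w + EuclideanSpace.single 1 s) : 𝕊 3) : 𝔼 4) with hF₃
    have h0 : (((reflectLast 3 (ν (circlePoint θ, planeFlip w)) : 𝕊 3) : 𝔼 4)) =
        reflectLastCLM 3 (F₁ θ) := coe_reflectLast 3 _
    have h1 : (fun t : ℝ ↦ ((reflectLast 3 (ν (circlePoint t, planeFlip w)) : 𝕊 3) : 𝔼 4)) =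
        fun t ↦ reflectLastCLM 3 (F₁ t) := by
      funext t; exact coe_reflectLast 3 _
    have h2 : (fun s : ℝ ↦ ((reflectLast 3 (ν (circlePoint θ,
        planeFlip (w + EuclideanSpace.single 0 s))) : 𝕊 3) : 𝔼 4)) =
        fun s ↦ reflectLastCLM 3 (F₂ s) := by
      funext s; rw [map_add, planeFlip_single_zero]; exact coe_reflectLast 3 _
    have h3 : (fun s : ℝ ↦ ((reflectLast 3 (ν (circlePoint θ,
        planeFlip (w + EuclideanSpace.single 1 s))) : 𝕊 3) : 𝔼 4)) =
        fun s ↦ reflectLastCLM 3 ((fun s' ↦ F₃ (-s')) s) := by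
      funext s; rw [map_add, planeFlip_single_one]; exact coe_reflectLast 3 _
    have hd₁ : DifferentiableAt ℝ F₁ θ := ν.differentiableAt_row_fst _ _
    have hd₂ : DifferentiableAt ℝ F₂ 0 := ν.differentiableAt_row_snd _ _ 0 0
    have hd₃ : DifferentiableAt ℝ (fun s' ↦ F₃ (-s')) 0 :=
      (ν.differentiableAt_row_snd _ _ 1 _).comp (0 : ℝ) differentiable_neg.differentiableAt
    change 0 < Matrix.det (Matrix.of
      ![⇑(((reflectLast 3 (ν (circlePoint θ, planeFlip w)) : 𝕊 3) : 𝔼 4)),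
        ⇑(deriv (fun t : ℝ ↦ ((reflectLast 3 (ν (circlePoint t, planeFlip w)) : 𝕊 3) : 𝔼 4)) θ),
        ⇑(deriv (fun s : ℝ ↦ ((reflectLast 3 (ν (circlePoint θ,
          planeFlip (w + EuclideanSpace.single 0 s))) : 𝕊 3) : 𝔼 4)) 0),
        ⇑(deriv (fun s : ℝ ↦ ((reflectLast 3 (ν (circlePoint θ,
          planeFlip (w + EuclideanSpace.single 1 s))) : 𝕊 3) : 𝔼 4)) 0)])
    rw [h0, h1, h2, h3, deriv_clm_comp_apply _ hd₁, deriv_clm_comp_apply _ hd₂,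
      deriv_clm_comp_apply _ hd₃, deriv_comp_neg, neg_zero, det_of_reflect_neg]
    exact ν.det_pos θ (planeFlip w)

/-- The mirrored tubular neighbourhood as a function. [folklore] -/
@[simp] theorem mirror_apply (p : (𝕊 1) × (𝔼 2)) :
    ν.mirror p = reflectLast 3 (ν (p.1, planeFlip p.2)) := rfl

/-- The image of the mirrored tubular neighbourhood is the reflected image. [folklore] -/
theorem range_mirror : range ⇑ν.mirror = reflectLast 3 '' range ⇑ν := by
  have : ⇑ν.mirror = reflectLast 3 ∘ (⇑ν ∘
      ⇑((Diffeomorph.refl (𝓡 1) (𝕊 1) ∞).prodCongr planeFlip.toDiffeomorph)) := by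
    funext p; rfl
  rw [this, range_comp, (EquivLike.surjective _).range_comp]

/-- **The surgery relation of the mirrored tubular neighbourhood** is that of `ν` at the reflected
point after flipping the circle factor of the solid torus. [folklore] -/
theorem glueRel_mirror_iff (a : 𝕊 3) (b : (𝔼 2) × (𝕊 1)) :
    ν.mirror.glueRel a b ↔ ν.glueRel (reflectLast 3 a) (circleFactorFlip b) := by
  constructor
  · rintro ⟨u, t, ht, hb, ha⟩
    refine ⟨u, t, ht, hb, ?_⟩
    rw [ha, mirror_apply, reflectLast_reflectLast, map_smul, planeFlip_coe_sphere,
      circleFactorFlip_apply]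
  · rintro ⟨u, t, ht, hb, ha⟩
    refine ⟨u, t, ht, hb, ?_⟩
    simp only [circleFactorFlip_apply] at ha
    rw [mirror_apply, map_smul, planeFlip_coe_sphere]
    change a = reflectLast 3 (ν (u, t • ((reflectLast 1 b.2 : 𝕊 1) : 𝔼 2)))
    rw [← ha, reflectLast_reflectLast]

end Knot.TubularNbhd

/-! ### The framing of the mirrored tubular neighbourhood -/

namespace Knot.TubularNbhd

variable {K : Knot} (ν : Knot.TubularNbhd K)

/-- The mirrored tubular neighbourhood of a knot `K`, as a tubular neighbourhood of the mirrored
knot `K.mirror` (`⇑K.mirror = reflectLast 3 ∘ ⇑K` definitionally). [folklore] -/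
abbrev mirrorKnot : Knot.TubularNbhd (K.mirror : Knot) := ν.mirror

/-- The reflection `S³ ∖ K → S³ ∖ K.mirror` of the complements, as a continuous map. [folklore] -/
def toMirrorCompl (K : Knot) : C(K.complement, (K.mirror : Knot).complement) where
  toFun x := ⟨reflectLast 3 x, by
    rw [SphereEmbedding.mem_complement_iff, Knot.range_mirror,
      (involutive_reflectLast 3).injective.mem_set_image]
    exact x.2⟩
  continuous_toFun := ((continuous_reflectLast 3).comp continuous_subtype_val).subtype_mk _

/-- The base point of the mirrored tubular neighbourhood is the reflected base point. [folklore] -/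
theorem toMirrorCompl_basePoint : toMirrorCompl K ν.basePoint = ν.mirrorKnot.basePoint := by
  apply Subtype.ext
  change reflectLast 3 (ν (circlePoint 0, framingBaseVector)) =
    reflectLast 3 (ν (circlePoint 0, planeFlip framingBaseVector))
  rw [planeFlip_framingBaseVector]

/-- **The meridian of the mirrored tubular neighbourhood is the reflected, reversed meridian.**
[folklore] -/
theorem meridian_mirrorKnot : ν.mirrorKnot.meridian =
    (((ν.meridian.map (toMirrorCompl K).continuous).cast ν.toMirrorCompl_basePoint.symm
      ν.toMirrorCompl_basePoint.symm).symm) := by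
  apply Path.ext
  funext t
  apply Subtype.ext
  change reflectLast 3 (ν (circlePoint 0,
      planeFlip ((1 / 2 : ℝ) • ((circlePoint (2 * Real.pi * t) : 𝕊 1) : 𝔼 2)))) =
    reflectLast 3 (ν (circlePoint 0,
      (1 / 2 : ℝ) • ((circlePoint (2 * Real.pi * (unitInterval.symm t : ℝ)) : 𝕊 1) : 𝔼 2)))
  rw [map_smul, planeFlip_circlePoint, unitInterval.coe_symm_eq, circlePoint_two_pi_mul_one_sub]

/-- **The longitude of the mirrored tubular neighbourhood is the reflected longitude.** [folklore] -/
theorem longitude_mirrorKnot : ν.mirrorKnot.longitude =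
    (ν.longitude.map (toMirrorCompl K).continuous).cast ν.toMirrorCompl_basePoint.symm
      ν.toMirrorCompl_basePoint.symm := by
  apply Path.ext
  funext t
  apply Subtype.ext
  change reflectLast 3 (ν (circlePoint (2 * Real.pi * t), planeFlip framingBaseVector)) =
    reflectLast 3 (ν (circlePoint (2 * Real.pi * t), framingBaseVector))
  rw [planeFlip_framingBaseVector]

/-- **Mirroring negates the framing**: if `ν` has framing `m` then the mirrored tubular
neighbourhood `ν.mirrorKnot` of `K.mirror` has framing `-m`. Under the homomorphism of
abelianised fundamental groups induced by the reflection of complements, the longitude goes to the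
longitude and the meridian to the *inverse* of the meridian (`longitude_mirrorKnot`,
`meridian_mirrorKnot`), so `[λ] = m • [μ]` becomes `[λ'] = m • (-[μ'])`. Gompf–Stipsicz (1999),
§5.1 (mirror image: negate all framings); Rolfsen (1976), §9.H. [cite: GompfStipsicz1999, §5.1] -/
theorem HasFraming.mirrorKnot {m : ℤ} (h : ν.HasFraming m) : ν.mirrorKnot.HasFraming (-m) := by
  unfold HasFraming at h ⊢
  set G := FundamentalGroup.mapOfEq (toMirrorCompl K) ν.toMirrorCompl_basePoint with hG
  have h' := congrArg (Abelianization.map G) h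
  simp only [map_zpow, Abelianization.map_of] at h'
  rw [ν.meridian_mirrorKnot, ν.longitude_mirrorKnot,
    fromPath_mk_cast_map_eq _ ν.toMirrorCompl_basePoint,
    fromPath_mk_symm_cast_map_eq _ ν.toMirrorCompl_basePoint, map_inv, ← hG, h', inv_zpow', neg_neg]

end Knot.TubularNbhd


/-! ### Mirror image negates the linking number -/

namespace Knot

/-- The loop of the mirrored knot `J̄` in the complement of the mirrored knot `K̄` is the reflected
loop of `J` (same orientation). [folklore] -/
theorem loopInCompl_mirror (K J : Knot) (h : Disjoint (range ⇑K) (range ⇑J)) :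
    K.mirror.loopInCompl J.mirror (disjoint_range_mirror h) =
      (K.loopInCompl J h).map (TubularNbhd.toMirrorCompl K).continuous := by
  apply Path.ext
  funext t
  rfl

/-- **Mirror image negates the linking number**, for one pair of knots: if `lk(K, J) = l` then
`lk(K̄, J̄) = -l`, both knots being reflected by `reflectLast 3`. With the mirrored tubular
neighbourhood `ν.mirrorKnot` of `K̄` (whose meridian is the reflected *reversed* meridian,
`meridian_mirrorKnot`) and the reflected conjugating path, the class of the reflected loop
`γ · J · γ⁻¹` is the image of `l • [μ]` under the reflection, i.e. `l • (-[μ'])`. Rolfsen (1976),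
§5.D, remark after Thm 5.D.1; §3.C. [cite: Rolfsen1976, §5.D Thm 5.D.1] -/
theorem HasLinkingNumber.mirror' {K J : Knot} {h : Disjoint (range ⇑K) (range ⇑J)} {l : ℤ}
    (hl : K.HasLinkingNumber J h l) :
    K.mirror.HasLinkingNumber J.mirror (disjoint_range_mirror h) (-l) := by
  obtain ⟨ν, γ, hγ⟩ := hl
  set g := TubularNbhd.toMirrorCompl K with hg
  have hb := ν.toMirrorCompl_basePoint
  -- the reflected conjugating path, based at the base point of the mirrored neighbourhood
  let γ' : Path ν.mirrorKnot.basePoint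
      ⟨J.mirror (circlePoint 0), mem_complement_of_disjoint (disjoint_range_mirror h) _⟩ :=
    (γ.map g.continuous).cast hb.symm rfl
  refine ⟨ν.mirrorKnot, γ', ?_⟩
  have hpath : (γ'.trans (K.mirror.loopInCompl J.mirror (disjoint_range_mirror h))).trans γ'.symm =
      ((((γ.trans (K.loopInCompl J h)).trans γ.symm).map g.continuous).cast hb.symm hb.symm) := by
    rw [Path.map_trans, Path.map_trans, ← Path.map_symm]
    rfl
  set G := FundamentalGroup.mapOfEq g hb with hG
  have h' := congrArg (Abelianization.map G) hγ
  simp only [map_zpow, Abelianization.map_of] at h'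
  rw [hpath, fromPath_mk_cast_map_eq g hb, ← hG, h', ν.meridian_mirrorKnot,
    fromPath_mk_symm_cast_map_eq _ ν.toMirrorCompl_basePoint, ← hG, map_inv, inv_zpow', neg_neg]

/-- Discharge of the named fact `HasLinkingNumber.mirror` (`LinkingNumber.lean`):
**`lk(K̄, J̄) = -lk(K, J)`**. Rolfsen (1976), §5.D, remark after Thm 5.D.1.
[cite: Rolfsen1976, §5.D Thm 5.D.1] -/
theorem HasLinkingNumber.mirror_holds : HasLinkingNumber.mirror :=
  fun hl ↦ hl.mirror'

end Knot

/-! ### Surgery on the mirror image of a framed link -/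

namespace Link

variable {ι : Type*} [Finite ι]

/-- The reflection `reflectLast 3` restricts to a diffeomorphism from the complement of the mirror
image of a link onto the complement of the link (an involution of `S³` exchanging the two).
[folklore] -/
def mirrorComplDiffeo (L : Link ι) (L' : Link ι) (hL : ∀ i, L'.component i = (L.component i).mirror) :
    L'.complement ≃ₘ⟮𝓡 3, 𝓡 3⟯ L.complement where
  toFun a := ⟨reflectLast 3 a, by
    rw [mem_complement_iff]
    rintro i ⟨y, hy⟩
    have : (L'.component i) y = (a : 𝕊 3) := by
      rw [hL, SphereEmbedding.coe_mirror, comp_apply, hy, reflectLast_reflectLast]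
    exact (mem_complement_iff L' a).1 a.2 i ⟨y, this⟩⟩
  invFun a := ⟨reflectLast 3 a, by
    rw [mem_complement_iff]
    rintro i ⟨y, hy⟩
    rw [hL, SphereEmbedding.coe_mirror, comp_apply] at hy
    exact (mem_complement_iff L a).1 a.2 i ⟨y, (involutive_reflectLast 3).injective hy⟩⟩
  left_inv a := Subtype.ext (reflectLast_reflectLast 3 _)
  right_inv a := Subtype.ext (reflectLast_reflectLast 3 _)
  contMDiff_toFun := (ContMDiff.subtypeVal_comp_iff L.complement _).1
    ((contMDiff_reflectLast 3).comp contMDiff_subtype_val)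
  contMDiff_invFun := (ContMDiff.subtypeVal_comp_iff L'.complement _).1
    ((contMDiff_reflectLast 3).comp contMDiff_subtype_val)

/-- The mirror complement diffeomorphism on points: it is the reflection. [folklore] -/
@[simp] theorem coe_mirrorComplDiffeo_apply (L L' : Link ι)
    (hL : ∀ i, L'.component i = (L.component i).mirror) (a : L'.complement) :
    (mirrorComplDiffeo L L' hL a : 𝕊 3) = reflectLast 3 a := rfl

/-- Precomposing with the mirror complement diffeomorphism does not change the image. [folklore] -/
theorem range_comp_mirrorComplDiffeo {Y : Type*} (L L' : Link ι)
    (hL : ∀ i, L'.component i = (L.component i).mirror) (f : L.complement → Y) :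
    range (f ∘ mirrorComplDiffeo L L' hL) = range f :=
  (EquivLike.surjective (mirrorComplDiffeo L L' hL)).range_comp f

end Link

namespace FramedLink

/-- **Surgery on the mirror image of a framed link** (same manifold, same model): if `Y` is
surgery on `L` then `Y` is surgery on `L.mirror` (all components reflected, all framings negated)
— mirror the tubular neighbourhoods (`Knot.TubularNbhd.mirrorKnot`: oriented by
`det_of_reflect_neg`, framing `-nᵢ` by `HasFraming.mirrorKnot`), precompose the embedding of the
link complement with the reflection (`Link.mirrorComplDiffeo`) and the embeddings of the solid tori
with the circle-factor flip (`solidTorusCircleFlip`), which matches the surgery relations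
(`glueRel_mirror_iff`). As an unoriented manifold `Y` is unchanged; the orientation inherited from
`S³` is reversed. Gompf–Stipsicz (1999), §5.1; Rolfsen (1976), §9.H. [cite: GompfStipsicz1999, §5.1] -/
theorem IsSurgery.mirror {EY HY : Type*} [NormedAddCommGroup EY] [NormedSpace ℝ EY]
    [TopologicalSpace HY] {IY : ModelWithCorners ℝ EY HY} {Y : Type*} [TopologicalSpace Y]
    [ChartedSpace HY Y] {ι : Type*} [Finite ι] {L : FramedLink ι} (h : L.IsSurgery IY Y) :
    L.mirror.IsSurgery IY Y := by
  obtain ⟨ν, hν, hdisj, jA, jB, hA, hAo, hB, hcov, hBdisj, hglue⟩ := h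
  refine ⟨fun i ↦ (ν i).mirrorKnot, fun i ↦ ?_, fun i j hij ↦ ?_, ?_⟩
  · exact Knot.TubularNbhd.HasFraming.mirrorKnot (ν i) (hν i)
  · change Disjoint (range ⇑(ν i).mirror) (range ⇑(ν j).mirror)
    rw [Knot.TubularNbhd.range_mirror, Knot.TubularNbhd.range_mirror]
    exact (Set.disjoint_image_iff (involutive_reflectLast 3).injective).2 (hdisj hij)
  simp only [Link.surgeryRel]
  refine ⟨jA ∘ Link.mirrorComplDiffeo L.toLink L.mirror.toLink (fun _ ↦ rfl),
    fun i ↦ jB i ∘ solidTorusCircleFlip, hA.comp_diffeomorph _, ?_, fun i ↦ ?_, ?_, fun i j hij ↦ ?_,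
    fun i a b ↦ ?_⟩
  · rw [Link.range_comp_mirrorComplDiffeo]
    exact hAo
  · refine ⟨(hB i).1.comp_diffeomorph solidTorusCircleFlip, ?_⟩
    rw [range_comp_solidTorusCircleFlip]
    exact (hB i).2
  · simp only [range_comp_solidTorusCircleFlip, Link.range_comp_mirrorComplDiffeo]
    exact hcov
  · change Disjoint (range (jB i ∘ solidTorusCircleFlip)) (range (jB j ∘ solidTorusCircleFlip))
    rw [range_comp_solidTorusCircleFlip, range_comp_solidTorusCircleFlip]
    exact hBdisj hij
  · change jA (Link.mirrorComplDiffeo L.toLink L.mirror.toLink (fun _ ↦ rfl) a) =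
        jB i (solidTorusCircleFlip b) ↔ (ν i).mirror.glueRel a b
    rw [hglue i _ (solidTorusCircleFlip b)]
    exact ((ν i).glueRel_mirror_iff a b).symm

/-- Discharge of the named fact `FramedLink.isSurgery_mirror_iff` (`KirbyMoves.lean`): **`Y` is
surgery on the mirrored framed link `L̄` (framings negated) iff it is surgery on `L`** — both
directions are `IsSurgery.mirror`, using `L.mirror.mirror = L`. Gompf–Stipsicz (1999), §5.1;
Rolfsen (1976), §9.H. [cite: GompfStipsicz1999, §5.1] -/
theorem isSurgery_mirror_iff_holds : isSurgery_mirror_iff.{w, u'} := by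
  intro Y _ _ _ _ _ ι _ L
  refine ⟨fun h ↦ ?_, fun h ↦ h.mirror⟩
  have := h.mirror
  rwa [FramedLink.mirror_mirror] at this

end FramedLink

end Literature.Topology.FourManifolds
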